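/-
b2b-lace packet, LEAN TYPING SEAT 2 gen 15 (unit `b2b-lace-lean2-g15`).  Re-filed gen 16 (unit `b2b-lace-lean2-g16`): text identical except that the re-declared `F3Bounds.m3_nonneg` (gate dedup bounce of p192022: the name now lives in `F3BoundsTablesMono`, p192515) is dropped and its one use inlined (`(abs_nonneg _).trans (le_max_left _ _)`).  (S2b)-IMPR, the H₃ and H₅ leaves (L5, L7) AT THE INTEGRAL LEVEL:
[NoBLE17] §3.3.5 Steps 3 and 5 integrated against the `(l,x)`-kernel, landing on `F3Bounds.boundH3` / `boundH5` at the true `U`-tables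
`srwU`.  Print-faithful ((3.77), (3.86)); d-generic; no numeral, no dimension, no named fact; every existing module untouched.
-/
import Literature.Probability.FitznerVanDerHofstad2017.NobleH4StepD75
import HarnessLib

/-!
# Literature.Probability.FitznerVanDerHofstad2017.NobleH35Step — Steps 3 and 5 of [NoBLE17] §3.3.5 integrated against the `(l,x)`-kernel

[NoBLE17] = Fitzner–van der Hofstad, *Generalized approach to the non-backtracking lace expansion*, PTRF 169 (2017) 1041–1119.

The Step-3 and Step-5 pieces of the weighted diagram are `ℋ^{n,l}_{i,z}(x) = ∫ Ĥ_i(k) D̂(k)^l Ĝ_z(k)ⁿ D̂^{(x)}(k) dk/(2π)^d`, `i = 3, 5`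
((3.58); kernel atoms `LapAtoms.H3`, `LapAtoms.H5` of `NobleLaplacianSplit`).  `NobleLaplacianBounds` proves the pointwise bounds in TABLE
SHAPE: `KeyBounds.abs_H3_le` — `|Ĥ₃| ≤ 2K̲² β_{α,Φ}(β_{|ΔR,F|}/α̲_F + m₃) D̂^{sin} Ĉ² + 2K̲² Γ₂′ (ᾱ_F m₃ + β_{|ΔR,F|}) D̂^{sin} Ĉ³` ((3.76)),
and `KeyBounds.abs_H5_le` — `|Ĥ₅| ≤ 2K̲² Γ₂′ (2ᾱ_F β_{|ΔR,F|} + β_{|ΔR,F|}²) D̂^{sin} Ĉ³ + 2K̲² (ᾱ_F β_{ΔR,Φ} + (β_{α,Φ} + β_{ΔR,Φ}) β_{|ΔR,F|}) D̂^{sin} Ĉ²`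
((3.85)), `Ĉ = 1/[1 − D̂]`, `m₃ = F3Bounds.m3 r = max(|α̲_F − 1|, |ᾱ_F − 1|)`.  With the `n` two-point lines (`|Ĝ| ≤ Γ₂′ Ĉ`, (3.47)) and the
dictionary `∫ D̂^{sin} Ĉ^m |D̂|^l |D̂^{(x)}| dk/(2π)^d = U_{m,l}(x) = srwU d m l x` ((3.38), `SrwIntegralTU`), THIS MODULE proves, for any family of
atoms `A k` obeying `KeyBounds r` at every `k` of the cube with `D̂(k) < 1` (what `keyBounds_and_split` delivers for `lapAtomsAt` below `p_c` under
`f₂ ≤ Γ₂`) and carrying `D = D̂(k)`, `Dsin = D̂^{sin}(k)`, and `d ≥ 2n + 7` (integrability of `Ĉ^{n+3}`):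

  `|∫ Ĥ₃ Ĝⁿ D̂^l D̂^{(x)} dk/(2π)^d| ≤ 2K̲² Γ₂′ⁿ β_{α,Φ}(β_{|ΔR,F|}/α̲_F + m₃) U_{n+2,l}(x) + 2K̲² Γ₂′^{n+1}(ᾱ_F m₃ + β_{|ΔR,F|}) U_{n+3,l}(x) = F3Bounds.boundH3 τ n l x r`,
  `|∫ Ĥ₅ Ĝⁿ D̂^l D̂^{(x)} dk/(2π)^d| ≤ 2K̲² Γ₂′^{n+1}(2ᾱ_F β_{|ΔR,F|} + β_{|ΔR,F|}²) U_{n+3,l}(x) + 2K̲² Γ₂′ⁿ(ᾱ_F β_{ΔR,Φ} + (β_{α,Φ} + β_{ΔR,Φ})β_{|ΔR,F|}) U_{n+2,l}(x) = F3Bounds.boundH5 τ n l x r`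

for every table `τ` with `τ.U = srwU d` — the right sides of (3.77) and (3.86) = `General.nb` `BoundH[3]`, `BoundH[5]` VERBATIM (no divergence in
these two steps).  Pattern = `NobleH4StepD75` (integral monotonicity against the integrable majorant via the generic two-monomial shell
`integral_div_le_of_le_two_monomials`; the left integrand need not be shown integrable).  These are the (S2b)-IMPR leaves L5 and L7 of LEMMAS (I3);
L3 (H₁: the `IM = 𝓙` dictionary and the Ĉ* expansion (3.61)–(3.71)) and L4 (H₂: `|M̂*|` against the `T`-integrand) are NOT in this module.
[cite: FitznerVanDerHofstad2016NoBLE, §3.3.5 Step 3 (3.75)–(3.77) p. 1077 and Step 5 (3.79)–(3.86) pp. 1078–1079, with (3.58) p. 1074, §3.3.4 (3.38),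
 (3.46)–(3.47) pp. 1071–1072; FitznerVanDerHofstad2017, notebook General.nb In[2] `BoundH[3]`, `BoundH[5]`; HeydenreichVanDerHofstad2017, Prop. 5.5]
-/

noncomputable section

open MeasureTheory Real
open Literature.Barriers.CriticalPhenomena
open Literature.Barriers.CriticalPhenomena.Slade2006Prop53 (P)
open Literature.Probability.LatticeModels

namespace Literature.Probability.FitznerVanDerHofstad2017

variable {d : ℕ}

/-! ## A generic integration shell: two monomials -/

/-- If `0 ≤ f` and `f ≤ c₁ F₁ + c₂ F₂` at every `k` of the cube with `D̂(k) < 1`, with `F₁, F₂` integrable, then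
`∫ f dk/(2π)^d ≤ c₁ ∫ F₁ dk/(2π)^d + c₂ ∫ F₂ dk/(2π)^d` (`f` itself need not be shown integrable). [folklore] -/
theorem integral_div_le_of_le_two_monomials (hd : 1 ≤ d) {f F₁ F₂ : (Fin d → ℝ) → ℝ} {c₁ c₂ : ℝ}
    (hf : ∀ k, 0 ≤ f k) (hF₁ : Integrable F₁ (P d)) (hF₂ : Integrable F₂ (P d))
    (h : ∀ k ∈ cube d, Dhat d k < 1 → f k ≤ c₁ * F₁ k + c₂ * F₂ k) :
    (∫ k, f k ∂P d) / (2 * π) ^ d ≤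
      c₁ * ((∫ k, F₁ k ∂P d) / (2 * π) ^ d) + c₂ * ((∫ k, F₂ k ∂P d) / (2 * π) ^ d) := by
  have hle : (∫ k, f k ∂P d) ≤ ∫ k, c₁ * F₁ k + c₂ * F₂ k ∂P d := by
    refine integral_mono_of_nonneg (ae_of_all _ hf) ((hF₁.const_mul c₁).add (hF₂.const_mul c₂)) ?_
    filter_upwards [ae_mem_cube_and_Dhat_lt_one hd] with k hk
    exact h k hk.1 hk.2
  rw [integral_add (hF₁.const_mul c₁) (hF₂.const_mul c₂), integral_const_mul, integral_const_mul] at hle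
  have h2 := two_pi_pow_pos d
  calc (∫ k, f k ∂P d) / (2 * π) ^ d ≤ (c₁ * ∫ k, F₁ k ∂P d + c₂ * ∫ k, F₂ k ∂P d) / (2 * π) ^ d :=
        div_le_div_of_nonneg_right hle h2.le
    _ = _ := by ring

/-! ## Pointwise: Steps 3 and 5 with the `n` two-point lines -/

namespace LapAtoms.KeyBounds

variable {a : LapAtoms} {r : F3Bounds.Args} (h : a.KeyBounds r)
include h

/-- `ᾱ_F ≥ 0` (`0 < α̲_F ≤ α_F ≤ ᾱ_F`). [folklore] -/
theorem afmax_nn : 0 ≤ r.afmax := h.afmin_pos.le.trans (h.αF_ge.trans h.αF_le)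

/-- **Step 3 with the `n` two-point lines, pointwise**: `|Ĝ|ⁿ |Ĥ₃| ≤ 2K̲² Γ₂′ⁿ β_{α,Φ}(β_{|ΔR,F|}/α̲_F + m₃) D̂^{sin} Ĉ^{n+2}
+ 2K̲² Γ₂′^{n+1}(ᾱ_F m₃ + β_{|ΔR,F|}) D̂^{sin} Ĉ^{n+3}` — the integrand of (3.77).
[cite: FitznerVanDerHofstad2016NoBLE, §3.3.5 (3.76)–(3.77) p. 1077 with §3.3.4 (3.47) p. 1072] -/
theorem pow_abs_G_mul_abs_H3_le (n : ℕ) :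
    |a.G| ^ n * |a.H3| ≤
      2 * r.Kunderline ^ 2 * r.Gamma2dash ^ n * r.ap * (r.bRfDelta / r.afmin + F3Bounds.m3 r) *
          (a.Dsin * (1 / (1 - a.D)) ^ (n + 2)) +
        2 * r.Kunderline ^ 2 * r.Gamma2dash ^ (n + 1) * (r.afmax * F3Bounds.m3 r + r.bRfDelta) *
          (a.Dsin * (1 / (1 - a.D)) ^ (n + 3)) := by
  have hC : 0 < 1 / (1 - a.D) := h.C_pos
  have hK : 0 ≤ r.Kunderline := h.K_nn
  have hΓ : 0 ≤ r.Gamma2dash := h.Gamma2dash_nn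
  have hbF : 0 ≤ r.bRfDelta := h.bRfDelta_nn
  have hap : 0 ≤ r.ap := h.ap_nn
  have haf : 0 < r.afmin := h.afmin_pos
  have hm : 0 ≤ F3Bounds.m3 r := (abs_nonneg _).trans (le_max_left _ _)
  have hafx : 0 ≤ r.afmax := h.afmax_nn
  have hDs : 0 ≤ a.Dsin := h.Dsin_nn
  have hG : |a.G| ^ n ≤ (r.Gamma2dash * (1 / (1 - a.D))) ^ n :=
    pow_le_pow_left₀ (abs_nonneg _) h.abs_G_le n
  calc |a.G| ^ n * |a.H3|
      ≤ (r.Gamma2dash * (1 / (1 - a.D))) ^ n *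
          (2 * r.Kunderline ^ 2 * r.ap * (r.bRfDelta / r.afmin + F3Bounds.m3 r) * (a.Dsin * (1 / (1 - a.D)) ^ 2) +
            2 * r.Kunderline ^ 2 * r.Gamma2dash * (r.afmax * F3Bounds.m3 r + r.bRfDelta) *
              (a.Dsin * (1 / (1 - a.D)) ^ 3)) :=
        mul_le_mul hG h.abs_H3_le (abs_nonneg _) (by positivity)
    _ = _ := by ring

/-- **Step 5 with the `n` two-point lines, pointwise**: `|Ĝ|ⁿ |Ĥ₅| ≤ 2K̲² Γ₂′^{n+1}(2ᾱ_F β_{|ΔR,F|} + β_{|ΔR,F|}²) D̂^{sin} Ĉ^{n+3}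
+ 2K̲² Γ₂′ⁿ(ᾱ_F β_{ΔR,Φ} + (β_{α,Φ} + β_{ΔR,Φ}) β_{|ΔR,F|}) D̂^{sin} Ĉ^{n+2}` — the integrand of (3.86).
[cite: FitznerVanDerHofstad2016NoBLE, §3.3.5 (3.85)–(3.86) pp. 1078–1079 with §3.3.4 (3.47) p. 1072] -/
theorem pow_abs_G_mul_abs_H5_le (n : ℕ) :
    |a.G| ^ n * |a.H5| ≤
      2 * r.Kunderline ^ 2 * r.Gamma2dash ^ (n + 1) * (2 * r.afmax * r.bRfDelta + r.bRfDelta ^ 2) *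
          (a.Dsin * (1 / (1 - a.D)) ^ (n + 3)) +
        2 * r.Kunderline ^ 2 * r.Gamma2dash ^ n *
          (r.afmax * r.bRpDelta + (r.ap + r.bRpDelta) * r.bRfDelta) * (a.Dsin * (1 / (1 - a.D)) ^ (n + 2)) := by
  have hC : 0 < 1 / (1 - a.D) := h.C_pos
  have hK : 0 ≤ r.Kunderline := h.K_nn
  have hΓ : 0 ≤ r.Gamma2dash := h.Gamma2dash_nn
  have hbF : 0 ≤ r.bRfDelta := h.bRfDelta_nn
  have hbΦ : 0 ≤ r.bRpDelta := h.bRpDelta_nn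
  have hap : 0 ≤ r.ap := h.ap_nn
  have hafx : 0 ≤ r.afmax := h.afmax_nn
  have hDs : 0 ≤ a.Dsin := h.Dsin_nn
  have hG : |a.G| ^ n ≤ (r.Gamma2dash * (1 / (1 - a.D))) ^ n :=
    pow_le_pow_left₀ (abs_nonneg _) h.abs_G_le n
  calc |a.G| ^ n * |a.H5|
      ≤ (r.Gamma2dash * (1 / (1 - a.D))) ^ n *
          (2 * r.Kunderline ^ 2 * r.Gamma2dash * (2 * r.afmax * r.bRfDelta + r.bRfDelta ^ 2) *
              (a.Dsin * (1 / (1 - a.D)) ^ 3) +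
            2 * r.Kunderline ^ 2 * (r.afmax * r.bRpDelta + (r.ap + r.bRpDelta) * r.bRfDelta) *
              (a.Dsin * (1 / (1 - a.D)) ^ 2)) :=
        mul_le_mul hG h.abs_H5_le (abs_nonneg _) (by positivity)
    _ = _ := by ring

end LapAtoms.KeyBounds

/-! ## Integrated: Steps 3 and 5 against the `(l,x)`-kernel -/

section Integrated

variable {n : ℕ} {A : (Fin d → ℝ) → LapAtoms} {r : F3Bounds.Args}

/-- The `U`-dictionary: `∫ |D̂|^l |D̂^{(x)}| D̂^{sin} Ĉ^m dk = (2π)^d U_{m,l}(x)`. [cite: FitznerVanDerHofstad2016NoBLE, §3.3.4 (3.38) p. 1071] -/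
theorem integral_srwU_integrand_eq (m l : ℕ) (x : Fin d → ℤ) :
    (∫ k, (|Dhat d k| ^ l * |DhatSym d x k| * Dsin d k) * Chat d 1 k ^ m ∂P d) / (2 * π) ^ d = srwU d m l x := rfl

/-- **Step 3 integrated, absolute form**: `∫ |Ĝ|ⁿ |Ĥ₃| |D̂|^l |D̂^{(x)}| dk/(2π)^d ≤ 2K̲² Γ₂′ⁿ β_{α,Φ}(β_{|ΔR,F|}/α̲_F + m₃) U_{n+2,l}(x)
+ 2K̲² Γ₂′^{n+1}(ᾱ_F m₃ + β_{|ΔR,F|}) U_{n+3,l}(x)` (`d ≥ 2n + 7`). [cite: FitznerVanDerHofstad2016NoBLE, §3.3.5 (3.77) p. 1077; §3.3.4 (3.38) p. 1071] -/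
theorem integral_pow_abs_G_mul_abs_H3_weight_le (hd : 2 * (n + 3) + 1 ≤ d)
    (hA : ∀ k ∈ cube d, Dhat d k < 1 → (A k).KeyBounds r) (hAD : ∀ k, (A k).D = Dhat d k)
    (hADs : ∀ k, (A k).Dsin = Dsin d k) (l : ℕ) (x : Fin d → ℤ) :
    (∫ k, |(A k).G| ^ n * |(A k).H3| * (|Dhat d k| ^ l * |DhatSym d x k|) ∂P d) / (2 * π) ^ d ≤
      2 * r.Kunderline ^ 2 * r.Gamma2dash ^ n * r.ap * (r.bRfDelta / r.afmin + F3Bounds.m3 r) * srwU d (n + 2) l x +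
        2 * r.Kunderline ^ 2 * r.Gamma2dash ^ (n + 1) * (r.afmax * F3Bounds.m3 r + r.bRfDelta) * srwU d (n + 3) l x := by
  have hI2 := integrable_srwU_integrand (d := d) (n := n + 2) (by omega) l x
  have hI3 := integrable_srwU_integrand (d := d) (n := n + 3) (by omega) l x
  rw [← integral_srwU_integrand_eq (n + 2) l x, ← integral_srwU_integrand_eq (n + 3) l x]
  refine integral_div_le_of_le_two_monomials (by omega) (fun k => ?_) hI2 hI3 fun k hk hD => ?_
  · exact mul_nonneg (mul_nonneg (pow_nonneg (abs_nonneg _) n) (abs_nonneg _))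
      (mul_nonneg (pow_nonneg (abs_nonneg _) l) (abs_nonneg _))
  · have hb := (hA k hk hD).pow_abs_G_mul_abs_H3_le n
    have hC : 1 / (1 - (A k).D) = Chat d 1 k := by rw [hAD, Chat, one_mul]
    rw [hC, hADs] at hb
    have hw : 0 ≤ |Dhat d k| ^ l * |DhatSym d x k| := mul_nonneg (pow_nonneg (abs_nonneg _) l) (abs_nonneg _)
    calc |(A k).G| ^ n * |(A k).H3| * (|Dhat d k| ^ l * |DhatSym d x k|)
        ≤ (2 * r.Kunderline ^ 2 * r.Gamma2dash ^ n * r.ap * (r.bRfDelta / r.afmin + F3Bounds.m3 r) *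
              (Dsin d k * Chat d 1 k ^ (n + 2)) +
            2 * r.Kunderline ^ 2 * r.Gamma2dash ^ (n + 1) * (r.afmax * F3Bounds.m3 r + r.bRfDelta) *
              (Dsin d k * Chat d 1 k ^ (n + 3))) * (|Dhat d k| ^ l * |DhatSym d x k|) :=
          mul_le_mul_of_nonneg_right hb hw
      _ = _ := by ring

/-- **Step 5 integrated, absolute form**: `∫ |Ĝ|ⁿ |Ĥ₅| |D̂|^l |D̂^{(x)}| dk/(2π)^d ≤ 2K̲² Γ₂′^{n+1}(2ᾱ_F β_{|ΔR,F|} + β_{|ΔR,F|}²) U_{n+3,l}(x)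
+ 2K̲² Γ₂′ⁿ(ᾱ_F β_{ΔR,Φ} + (β_{α,Φ} + β_{ΔR,Φ}) β_{|ΔR,F|}) U_{n+2,l}(x)` (`d ≥ 2n + 7`).
[cite: FitznerVanDerHofstad2016NoBLE, §3.3.5 (3.86) p. 1079; §3.3.4 (3.38) p. 1071] -/
theorem integral_pow_abs_G_mul_abs_H5_weight_le (hd : 2 * (n + 3) + 1 ≤ d)
    (hA : ∀ k ∈ cube d, Dhat d k < 1 → (A k).KeyBounds r) (hAD : ∀ k, (A k).D = Dhat d k)
    (hADs : ∀ k, (A k).Dsin = Dsin d k) (l : ℕ) (x : Fin d → ℤ) :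
    (∫ k, |(A k).G| ^ n * |(A k).H5| * (|Dhat d k| ^ l * |DhatSym d x k|) ∂P d) / (2 * π) ^ d ≤
      2 * r.Kunderline ^ 2 * r.Gamma2dash ^ (n + 1) * (2 * r.afmax * r.bRfDelta + r.bRfDelta ^ 2) * srwU d (n + 3) l x +
        2 * r.Kunderline ^ 2 * r.Gamma2dash ^ n *
          (r.afmax * r.bRpDelta + (r.ap + r.bRpDelta) * r.bRfDelta) * srwU d (n + 2) l x := by
  have hI2 := integrable_srwU_integrand (d := d) (n := n + 2) (by omega) l x
  have hI3 := integrable_srwU_integrand (d := d) (n := n + 3) (by omega) l x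
  rw [← integral_srwU_integrand_eq (n + 2) l x, ← integral_srwU_integrand_eq (n + 3) l x]
  refine integral_div_le_of_le_two_monomials (by omega) (fun k => ?_) hI3 hI2 fun k hk hD => ?_
  · exact mul_nonneg (mul_nonneg (pow_nonneg (abs_nonneg _) n) (abs_nonneg _))
      (mul_nonneg (pow_nonneg (abs_nonneg _) l) (abs_nonneg _))
  · have hb := (hA k hk hD).pow_abs_G_mul_abs_H5_le n
    have hC : 1 / (1 - (A k).D) = Chat d 1 k := by rw [hAD, Chat, one_mul]
    rw [hC, hADs] at hb
    have hw : 0 ≤ |Dhat d k| ^ l * |DhatSym d x k| := mul_nonneg (pow_nonneg (abs_nonneg _) l) (abs_nonneg _)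
    calc |(A k).G| ^ n * |(A k).H5| * (|Dhat d k| ^ l * |DhatSym d x k|)
        ≤ (2 * r.Kunderline ^ 2 * r.Gamma2dash ^ (n + 1) * (2 * r.afmax * r.bRfDelta + r.bRfDelta ^ 2) *
              (Dsin d k * Chat d 1 k ^ (n + 3)) +
            2 * r.Kunderline ^ 2 * r.Gamma2dash ^ n *
              (r.afmax * r.bRpDelta + (r.ap + r.bRpDelta) * r.bRfDelta) * (Dsin d k * Chat d 1 k ^ (n + 2))) *
            (|Dhat d k| ^ l * |DhatSym d x k|) :=
          mul_le_mul_of_nonneg_right hb hw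
      _ = _ := by ring

/-- The signed (3.58) integrand of Step `i` has absolute value `|Ĝ|ⁿ |Ĥ_i| |D̂|^l |D̂^{(x)}|`. [folklore] -/
theorem abs_diagram_integrand_eq (H G D S : ℝ) (n l : ℕ) :
    |H * G ^ n * D ^ l * S| = |G| ^ n * |H| * (|D| ^ l * |S|) := by
  simp only [abs_mul, abs_pow]; ring

/-- **Step 3 for the signed diagram integrand**: `|∫ Ĥ₃ Ĝⁿ D̂^l D̂^{(x)} dk/(2π)^d| ≤` the right side of (3.77) at the `U`-integrals.
[cite: FitznerVanDerHofstad2016NoBLE, §3.3.5 (3.58) p. 1074 and (3.77) p. 1077] -/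
theorem abs_integral_H3_diagram_le (hd : 2 * (n + 3) + 1 ≤ d)
    (hA : ∀ k ∈ cube d, Dhat d k < 1 → (A k).KeyBounds r) (hAD : ∀ k, (A k).D = Dhat d k)
    (hADs : ∀ k, (A k).Dsin = Dsin d k) (l : ℕ) (x : Fin d → ℤ) :
    |(∫ k, (A k).H3 * (A k).G ^ n * Dhat d k ^ l * DhatSym d x k ∂P d) / (2 * π) ^ d| ≤
      2 * r.Kunderline ^ 2 * r.Gamma2dash ^ n * r.ap * (r.bRfDelta / r.afmin + F3Bounds.m3 r) * srwU d (n + 2) l x +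
        2 * r.Kunderline ^ 2 * r.Gamma2dash ^ (n + 1) * (r.afmax * F3Bounds.m3 r + r.bRfDelta) * srwU d (n + 3) l x := by
  rw [abs_div, abs_of_pos (two_pi_pow_pos d)]
  refine le_trans (div_le_div_of_nonneg_right abs_integral_le_integral_abs (two_pi_pow_pos d).le) ?_
  simp only [abs_diagram_integrand_eq]
  exact integral_pow_abs_G_mul_abs_H3_weight_le hd hA hAD hADs l x

/-- **Step 5 for the signed diagram integrand**: `|∫ Ĥ₅ Ĝⁿ D̂^l D̂^{(x)} dk/(2π)^d| ≤` the right side of (3.86) at the `U`-integrals.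
[cite: FitznerVanDerHofstad2016NoBLE, §3.3.5 (3.58) p. 1074 and (3.86) p. 1079] -/
theorem abs_integral_H5_diagram_le (hd : 2 * (n + 3) + 1 ≤ d)
    (hA : ∀ k ∈ cube d, Dhat d k < 1 → (A k).KeyBounds r) (hAD : ∀ k, (A k).D = Dhat d k)
    (hADs : ∀ k, (A k).Dsin = Dsin d k) (l : ℕ) (x : Fin d → ℤ) :
    |(∫ k, (A k).H5 * (A k).G ^ n * Dhat d k ^ l * DhatSym d x k ∂P d) / (2 * π) ^ d| ≤
      2 * r.Kunderline ^ 2 * r.Gamma2dash ^ (n + 1) * (2 * r.afmax * r.bRfDelta + r.bRfDelta ^ 2) * srwU d (n + 3) l x +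
        2 * r.Kunderline ^ 2 * r.Gamma2dash ^ n *
          (r.afmax * r.bRpDelta + (r.ap + r.bRpDelta) * r.bRfDelta) * srwU d (n + 2) l x := by
  rw [abs_div, abs_of_pos (two_pi_pow_pos d)]
  refine le_trans (div_le_div_of_nonneg_right abs_integral_le_integral_abs (two_pi_pow_pos d).le) ?_
  simp only [abs_diagram_integrand_eq]
  exact integral_pow_abs_G_mul_abs_H5_weight_le hd hA hAD hADs l x

/-- **Tables form, Step 3**: for a table with `τ.U = srwU d` the bound is `F3Bounds.boundH3 τ n l x r` = (3.77) = `General.nb` `BoundH[3]`.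
[cite: FitznerVanDerHofstad2016NoBLE, §3.3.5 (3.77) p. 1077; FitznerVanDerHofstad2017, notebook General.nb In[2]] -/
theorem abs_integral_H3_diagram_le_boundH3 (hd : 2 * (n + 3) + 1 ≤ d)
    (hA : ∀ k ∈ cube d, Dhat d k < 1 → (A k).KeyBounds r) (hAD : ∀ k, (A k).D = Dhat d k)
    (hADs : ∀ k, (A k).Dsin = Dsin d k) (τ : F3Bounds.Tables (Fin d → ℤ)) (hU : ∀ m l x, τ.U m l x = srwU d m l x)
    (l : ℕ) (x : Fin d → ℤ) :
    |(∫ k, (A k).H3 * (A k).G ^ n * Dhat d k ^ l * DhatSym d x k ∂P d) / (2 * π) ^ d| ≤ F3Bounds.boundH3 τ n l x r := by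
  rw [F3Bounds.boundH3, hU, hU]
  exact abs_integral_H3_diagram_le hd hA hAD hADs l x

/-- **Tables form, Step 5**: for a table with `τ.U = srwU d` the bound is `F3Bounds.boundH5 τ n l x r` = (3.86) = `General.nb` `BoundH[5]`.
[cite: FitznerVanDerHofstad2016NoBLE, §3.3.5 (3.86) p. 1079; FitznerVanDerHofstad2017, notebook General.nb In[2]] -/
theorem abs_integral_H5_diagram_le_boundH5 (hd : 2 * (n + 3) + 1 ≤ d)
    (hA : ∀ k ∈ cube d, Dhat d k < 1 → (A k).KeyBounds r) (hAD : ∀ k, (A k).D = Dhat d k)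
    (hADs : ∀ k, (A k).Dsin = Dsin d k) (τ : F3Bounds.Tables (Fin d → ℤ)) (hU : ∀ m l x, τ.U m l x = srwU d m l x)
    (l : ℕ) (x : Fin d → ℤ) :
    |(∫ k, (A k).H5 * (A k).G ^ n * Dhat d k ^ l * DhatSym d x k ∂P d) / (2 * π) ^ d| ≤ F3Bounds.boundH5 τ n l x r := by
  rw [F3Bounds.boundH5, hU, hU]
  exact abs_integral_H5_diagram_le hd hA hAD hADs l x

end Integrated

/-! ## The atoms of `NobleLaplacianSplit` -/

/-- Step 3 at the atoms `lapAtomsAt` (whose `D`, `Dsin` fields are `D̂(k)`, `D̂^{sin}(k)` by construction), Tables form.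
[cite: FitznerVanDerHofstad2016NoBLE, §3.3.5 (3.58), (3.77) pp. 1074–1077] -/
theorem abs_integral_H3_diagram_le_boundH3_lapAtomsAt {n : ℕ} (hd : 2 * (n + 3) + 1 ≤ d)
    {cΦ αΦ cF αF : ℝ} {RΦ RF : Site d → ℝ} {r : F3Bounds.Args}
    (hKB : ∀ k ∈ cube d, Dhat d k < 1 → (lapAtomsAt d cΦ αΦ cF αF RΦ RF k).KeyBounds r)
    (τ : F3Bounds.Tables (Fin d → ℤ)) (hU : ∀ m l x, τ.U m l x = srwU d m l x) (l : ℕ) (x : Fin d → ℤ) :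
    |(∫ k, (lapAtomsAt d cΦ αΦ cF αF RΦ RF k).H3 * (lapAtomsAt d cΦ αΦ cF αF RΦ RF k).G ^ n *
        Dhat d k ^ l * DhatSym d x k ∂P d) / (2 * π) ^ d| ≤ F3Bounds.boundH3 τ n l x r :=
  abs_integral_H3_diagram_le_boundH3 hd hKB (fun _ => rfl) (fun _ => rfl) τ hU l x

/-- Step 5 at the atoms `lapAtomsAt`, Tables form. [cite: FitznerVanDerHofstad2016NoBLE, §3.3.5 (3.58), (3.86) pp. 1074–1079] -/
theorem abs_integral_H5_diagram_le_boundH5_lapAtomsAt {n : ℕ} (hd : 2 * (n + 3) + 1 ≤ d)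
    {cΦ αΦ cF αF : ℝ} {RΦ RF : Site d → ℝ} {r : F3Bounds.Args}
    (hKB : ∀ k ∈ cube d, Dhat d k < 1 → (lapAtomsAt d cΦ αΦ cF αF RΦ RF k).KeyBounds r)
    (τ : F3Bounds.Tables (Fin d → ℤ)) (hU : ∀ m l x, τ.U m l x = srwU d m l x) (l : ℕ) (x : Fin d → ℤ) :
    |(∫ k, (lapAtomsAt d cΦ αΦ cF αF RΦ RF k).H5 * (lapAtomsAt d cΦ αΦ cF αF RΦ RF k).G ^ n *
        Dhat d k ^ l * DhatSym d x k ∂P d) / (2 * π) ^ d| ≤ F3Bounds.boundH5 τ n l x r :=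
  abs_integral_H5_diagram_le_boundH5 hd hKB (fun _ => rfl) (fun _ => rfl) τ hU l x

end Literature.Probability.FitznerVanDerHofstad2017

end
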